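import Summits.NavierStokesRegularity.FluidComputer.SymmetryClassProjectors
import Summits.NavierStokesRegularity.FluidComputer.LyapunovEigenvalueExclusion

/-!
# Class-wise 3-L certificates exclude eigenvalues of the whole operator — composed by name
(cap g7, cell `ns-blowup`, 2026-08-26)

HONEST FRAMING (human ruling D-0035): nothing here is a claim about Navier–Stokes blow-up.
WHAT THIS IS NOT: not NS evidence. MODEL/linear bookkeeping: the census sentence of
P-ONSET13-3L (STATUS l.4856 «I / II / III / IV / V STABLE AT R = 13 CERTIFIED-BY-SCRIPT ⇒
abc(1,1,1) at R = 13 LINEARLY STABLE», i.e. «all five symmetry classes certified ⇒ the whole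
linearisation `L₁₃` has no eigenvalue with `Re λ > ω`») as ONE tree theorem over an abstract
inner-product space, composed from

* `SymmetryClassProjectors` (p464382): (COL) ⇒ the class projectors `P_c = κ_c ∑_g χ_c(g) ρ(g)` sum
  to `1` and commute with the operator; (SCHUR) ⇒ matrix units and the one-copy transfer;
* `LyapunovEigenvalueExclusion` (p442795): hypothesis (L) `Re⟪G w, A w⟫ ≤ ω·Re⟪G w, w⟫` on a domain
  with a symmetric positive weight ⇒ every eigenpair with eigenvector in the domain has `Re λ ≤ ω`.

Shape of the assembly (`re_eigenvalue_le_of_classwise`): a CLASS CERTIFICATE for class `c` at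
`(λ, ω)` is the sentence «every eigenvector of `A` for `λ` inside `range P_c` forces `Re λ ≤ ω`»;
under (COL) and `Commute (ρ g) A`, class certificates for ALL classes give `Re λ ≤ ω` for every
eigenpair of `A` on the whole space. A class certificate is DISCHARGED either

* on the whole isotypic component — `classCert_of_generator_form_on`: a 3-L certificate (weight
  `G_c`, lower bound `m_c > 0`, (L) on `range P_c`), as d2_cert runs classes I, II, III; or
* on ONE COPY — `classCert_of_oneCopy`: a 3-L certificate on `range p_{i₀ i₀}` for the matrix units
  of an irreducible matrix representation `r_c` with (SCHUR) and `P_c = ∑_α p_{αα}`, as d2_cert v1.8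
  runs classes IV1, V1 (`re_eigenvalue_le_of_oneCopy_certificate`).

What the instance still reads (D2-CHAIN-MAP): S1 (skc's reduced matrices are the sections of `A` on
`range P_c` / `range p₁₁`; `ρ` is a representation of `Γ ≅ O`), the (COL)/(SCHUR) finite identities
(kernel for `O`: `CubeRotationOrthogonality`), and the five script VERDICT lines. `𝕜 = ℝ` or `ℂ`;
Mathlib + the two files above; no definitions; std axioms. Nothing here is specific to
Navier–Stokes.
-/

noncomputable section

namespace Summit.NavierStokesRegularity.FluidComputer.ClasswiseExclusionAssembly

open RCLike Module Module.End
open scoped InnerProductSpace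

variable {𝕜 E : Type*} [RCLike 𝕜] [NormedAddCommGroup E] [InnerProductSpace 𝕜 E]
variable {G : Type*} [Group G] [Fintype G]

/-! ### §1 The assembly: class certificates for all classes ⇒ global exclusion -/

section Assembly

variable {ι : Type*} [Fintype ι]

/-- **All classes certified ⇒ the whole operator.** Under (COL) for the class projectors
`P_c = κ_c ∑_g χ_c(g) ρ(g)` and `A` commuting with the action: if for every class `c` every
eigenvector of `A` for `λ` inside `range P_c` forces `Re λ ≤ ω` (a CLASS CERTIFICATE at `(λ, ω)`),
then every eigenpair `A v = λ v`, `v ≠ 0`, of the whole operator has `Re λ ≤ ω`. -/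
theorem re_eigenvalue_le_of_classwise [DecidableEq G] (ρ : G →* Module.End 𝕜 E) (χ : ι → G → 𝕜)
    (κ : ι → 𝕜) (hcol : ∀ g : G, ∑ c, κ c * χ c g = if g = 1 then 1 else 0)
    (P : ι → Module.End 𝕜 E) (hP : ∀ c, P c = κ c • ∑ g, χ c g • ρ g) (A : Module.End 𝕜 E)
    (hA : ∀ g, Commute (ρ g) A) {ω : ℝ} {lam : 𝕜}
    (hcert : ∀ c, ∀ w ∈ LinearMap.range (P c), w ≠ 0 → A w = lam • w → re lam ≤ ω)
    {v : E} (hv0 : v ≠ 0) (hv : A v = lam • v) : re lam ≤ ω := by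
  obtain ⟨c, hc0, hc⟩ :=
    SymmetryClassProjectors.exists_classProj_eigenvector ρ χ κ hcol P hP A hA hv hv0
  exact hcert c (P c v) ⟨v, rfl⟩ hc0 hc

/-- Contrapositive census form: under (COL), class certificates at `(λ, ω)` for all classes and
`ω < Re λ` ⇒ `A` has no eigenvector for `λ`. -/
theorem no_eigenvector_of_classwise [DecidableEq G] (ρ : G →* Module.End 𝕜 E) (χ : ι → G → 𝕜)
    (κ : ι → 𝕜) (hcol : ∀ g : G, ∑ c, κ c * χ c g = if g = 1 then 1 else 0)
    (P : ι → Module.End 𝕜 E) (hP : ∀ c, P c = κ c • ∑ g, χ c g • ρ g) (A : Module.End 𝕜 E)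
    (hA : ∀ g, Commute (ρ g) A) {ω : ℝ} {lam : 𝕜}
    (hcert : ∀ c, ∀ w ∈ LinearMap.range (P c), w ≠ 0 → A w = lam • w → re lam ≤ ω)
    (hlam : ω < re lam) (v : E) (hv : A v = lam • v) : v = 0 := by
  by_contra hv0
  exact absurd (re_eigenvalue_le_of_classwise ρ χ κ hcol P hP A hA hcert hv0 hv) (not_le.2 hlam)

end Assembly

/-! ### §2 Discharging a class certificate on the whole component (classes I, II, III) -/

/-- **Whole-component 3-L certificate ⇒ class certificate.** A symmetric weight `Gw` with
`m‖x‖² ≤ Re⟪Gw x, x⟫` (`m > 0`) and hypothesis (L) on `range P` give the class certificate for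
`range P` at every `λ` (`LyapunovEigenvalueExclusion.re_eigenvalue_le_of_generator_form_on` with
`D = range P`). -/
theorem classCert_of_generator_form_on (P : Module.End 𝕜 E) (A : Module.End 𝕜 E) {Gw : E → E}
    (hG : ∀ x y : E, ⟪Gw x, y⟫_𝕜 = ⟪x, Gw y⟫_𝕜) {m ω : ℝ} (hm0 : 0 < m)
    (hm : ∀ x : E, m * ‖x‖ ^ 2 ≤ re ⟪Gw x, x⟫_𝕜)
    (hL : ∀ w ∈ LinearMap.range P, re ⟪Gw w, A w⟫_𝕜 ≤ ω * re ⟪Gw w, w⟫_𝕜) (lam : 𝕜) :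
    ∀ w ∈ LinearMap.range P, w ≠ 0 → A w = lam • w → re lam ≤ ω :=
  fun _ hw hw0 hAw =>
    LyapunovEigenvalueExclusion.re_eigenvalue_le_of_generator_form_on (A := fun x => A x)
      (D := (LinearMap.range P : Set E)) hG hm0 hm hL hw hw0 hAw

/-! ### §3 Discharging a class certificate on ONE COPY (classes IV, V) -/

section OneCopy

variable {m : Type*} [Fintype m] [DecidableEq m]

/-- Idempotency of the diagonal matrix-unit sum (from the relations
`p_{αα} p_{ββ} = [α = β] p_{αβ}`): `∑_α p_{αα} (∑_β p_{ββ} v) = ∑_α p_{αα} v`. -/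
theorem sum_diag_apply_sum_diag (ρ : G →* Module.End 𝕜 E) (r : G →* Matrix m m 𝕜) (κ : 𝕜)
    (hS : ∀ α β γ ε : m, κ * ∑ g, r g⁻¹ β α * r g ε γ = if α = ε ∧ β = γ then 1 else 0)
    (p : m → m → Module.End 𝕜 E) (hp : ∀ α β, p α β = κ • ∑ g, r g⁻¹ β α • ρ g) (v : E) :
    ∑ α, p α α (∑ β, p β β v) = ∑ α, p α α v := by
  refine Finset.sum_congr rfl fun α _ => ?_
  rw [map_sum]
  simp_rw [SymmetryClassProjectors.matrixUnit_apply_apply ρ r κ hS p hp]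
  simp [Finset.sum_ite_eq]

/-- **One-copy 3-L certificate ⇒ exclusion on the isotypic component.** Under (SCHUR) for the matrix
units `p α β` of class `c` and `A` commuting with the action: a symmetric weight `Gw` with
`m_c‖x‖² ≤ Re⟪Gw x, x⟫` (`m_c > 0`) and (L) on copy `i₀` (`range p_{i₀ i₀}`) force `Re λ ≤ ω` for
every eigenpair whose eigenvector lies in the isotypic component `{v | ∑_α p_{αα} v = v}`. -/
theorem re_eigenvalue_le_of_oneCopy_certificate (ρ : G →* Module.End 𝕜 E)
    (r : G →* Matrix m m 𝕜) (κ : 𝕜)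
    (hS : ∀ α β γ ε : m, κ * ∑ g, r g⁻¹ β α * r g ε γ = if α = ε ∧ β = γ then 1 else 0)
    (p : m → m → Module.End 𝕜 E) (hp : ∀ α β, p α β = κ • ∑ g, r g⁻¹ β α • ρ g)
    (A : Module.End 𝕜 E) (hA : ∀ g, Commute (ρ g) A) (i₀ : m) {Gw : E → E}
    (hG : ∀ x y : E, ⟪Gw x, y⟫_𝕜 = ⟪x, Gw y⟫_𝕜) {mc ω : ℝ} (hm0 : 0 < mc)
    (hm : ∀ x : E, mc * ‖x‖ ^ 2 ≤ re ⟪Gw x, x⟫_𝕜)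
    (hL : ∀ w ∈ LinearMap.range (p i₀ i₀), re ⟪Gw w, A w⟫_𝕜 ≤ ω * re ⟪Gw w, w⟫_𝕜)
    {v : E} {lam : 𝕜} (hcomp : ∑ α, p α α v = v) (hv0 : v ≠ 0) (hv : A v = lam • v) :
    re lam ≤ ω := by
  obtain ⟨w, hw, hw0, hAw⟩ := SymmetryClassProjectors.exists_eigenvector_mem_range_matrixUnit
    ρ r κ hS p hp A hA i₀ hcomp hv hv0
  exact LyapunovEigenvalueExclusion.re_eigenvalue_le_of_generator_form_on (A := fun x => A x)
    (D := (LinearMap.range (p i₀ i₀) : Set E)) hG hm0 hm hL hw hw0 hAw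

/-- **One-copy 3-L certificate ⇒ class certificate** for the class projector `P_c = ∑_α p_{αα}`
(`SymmetryClassProjectors.sum_matrixUnit_diag`: the character of the class is `κ·tr r(g⁻¹)`), in the
shape consumed by `re_eigenvalue_le_of_classwise`. -/
theorem classCert_of_oneCopy (ρ : G →* Module.End 𝕜 E) (r : G →* Matrix m m 𝕜) (κ : 𝕜)
    (hS : ∀ α β γ ε : m, κ * ∑ g, r g⁻¹ β α * r g ε γ = if α = ε ∧ β = γ then 1 else 0)
    (p : m → m → Module.End 𝕜 E) (hp : ∀ α β, p α β = κ • ∑ g, r g⁻¹ β α • ρ g)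
    (Pc : Module.End 𝕜 E) (hPc : ∀ v, Pc v = ∑ α, p α α v)
    (A : Module.End 𝕜 E) (hA : ∀ g, Commute (ρ g) A) (i₀ : m) {Gw : E → E}
    (hG : ∀ x y : E, ⟪Gw x, y⟫_𝕜 = ⟪x, Gw y⟫_𝕜) {mc ω : ℝ} (hm0 : 0 < mc)
    (hm : ∀ x : E, mc * ‖x‖ ^ 2 ≤ re ⟪Gw x, x⟫_𝕜)
    (hL : ∀ w ∈ LinearMap.range (p i₀ i₀), re ⟪Gw w, A w⟫_𝕜 ≤ ω * re ⟪Gw w, w⟫_𝕜) (lam : 𝕜) :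
    ∀ w ∈ LinearMap.range Pc, w ≠ 0 → A w = lam • w → re lam ≤ ω := by
  rintro w ⟨u, rfl⟩ hw0 hAw
  have hcomp : ∑ α, p α α (Pc u) = Pc u := by
    rw [hPc u]
    exact sum_diag_apply_sum_diag ρ r κ hS p hp u
  exact re_eigenvalue_le_of_oneCopy_certificate ρ r κ hS p hp A hA i₀ hG hm0 hm hL hcomp hw0 hAw

end OneCopy

end Summit.NavierStokesRegularity.FluidComputer.ClasswiseExclusionAssembly

end
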